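import Summits.MatrixMultiplication.MatrixMultiplication.Theses.LevelGradedCohnUmans
import Literature.NumberTheory.DiophantineGeometry.StandardFillings
import Literature.NumberTheory.DiophantineGeometry.PartitionTableauxProofs

/-!
# `SnLevelDesigns` (crux stmt-MatrixMultiplication-7613, route `LevelGradedCohnUmans`):
# the dead low corners and the load-bearing clauses (negative-side support, refuter cdisprove seat)

Sorry-free; nothing here asserts a route item positively.  `Sep n k X Y Z` is the crux's
`k`-token separation clause verbatim, `budget n k ε` its graded budget `∑_{μ₁ ≥ n-k} (f^μ)^{2+ε}`,
`volPow ε X Y Z = (|X||Y||Z|)^{(2+ε)/3}`, `At ε n k X Y Z` one instance, and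
`snLevelDesigns_iff : SnLevelDesigns ↔ ∀ ε > 0, ∃ n k X Y Z, At ε n k X Y Z` is `Iff.rfl`.

* `one_le_budget` — the budget is `≥ 1` always (the partition `(n)` pays `1^{2+ε}`).
* `not_at_of_card_le_one`, `not_at_of_le_one` — volume `≤ 1` (e.g. `n ≤ 1`) never works.
* `not_at_level_zero` — LEVEL `k = 0` IS DEAD for every `ε > 0` (constants separate only
  singletons: `card_mul_le_one_of_sep_zero`); any proof of the crux uses `k ≥ 1`.
* `numStandardTableaux_indiscrete` (`f^{(n)} = 1`, from the tree's Frobenius formula),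
  `budget_zero` (`budget n 0 ε = 1`).
* LOAD-BEARING: `exists_budget_lt_volPow` — without the separation clause the inequality is
  trivially satisfiable; `at_le_version_trivial` — with `≤` for `<` singletons at level 0 give
  equality, so the strict inequality is exactly what excludes this junk.
Companion files: `CoveringWall.lean`, `DimensionWalls.lean`; census and computations in
`Cruxes/SnLevelDesigns/Disproof.lean`.
-/

namespace Summit.MatrixMultiplication.MatrixMultiplication.Theorems.SnLevelDesigns.Negative

open scoped BigOperators
open Summit.MatrixMultiplication.MatrixMultiplication.Theses.LevelGradedCohnUmans
open Literature.NumberTheory.DiophantineGeometry (numStandardTableaux numStandardTableaux_pos_holds)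

noncomputable section

/-- `k`-token separation of a triple `X, Y, Z ⊆ 𝔖ₙ`, verbatim the first conjunct of the crux. -/
def Sep (n k : ℕ) (X Y Z : Finset (Equiv.Perm (Fin n))) : Prop :=
  ∀ x₀ ∈ X, ∀ z₀ ∈ Z, ∃ c : (Fin k → Fin n) → (Fin k → Fin n) → ℂ, ∀ x ∈ X, ∀ y ∈ Y, ∀ y' ∈ Y,
    ∀ z ∈ Z, (∑ p : Fin k → Fin n, c p (⇑(x⁻¹ * y * y'⁻¹ * z) ∘ p)) =
      if x = x₀ ∧ y = y' ∧ z = z₀ then 1 else 0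

/-- The graded budget `∑_{μ ⊢ n, μ₁ ≥ n-k} (f^μ)^{2+ε}`, verbatim the left side of the crux inequality. -/
def budget (n k : ℕ) (ε : ℝ) : ℝ :=
  ∑ μ : Nat.Partition n, if n - k ≤ μ.parts.sup then (numStandardTableaux μ : ℝ) ^ (2 + ε) else 0

/-- The volume side `(|X||Y||Z|)^{(2+ε)/3}`. -/
def volPow (ε : ℝ) {n : ℕ} (X Y Z : Finset (Equiv.Perm (Fin n))) : ℝ :=
  ((X.card * Y.card * Z.card : ℕ) : ℝ) ^ ((2 + ε) / 3)

/-- One instance of the crux at fixed `ε, n, k, X, Y, Z`. -/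
def At (ε : ℝ) (n k : ℕ) (X Y Z : Finset (Equiv.Perm (Fin n))) : Prop :=
  Sep n k X Y Z ∧ budget n k ε < volPow ε X Y Z

/-- The crux, restated through `At` (definitional). -/
theorem snLevelDesigns_iff :
    SnLevelDesigns ↔ ∀ ε : ℝ, 0 < ε → ∃ (n k : ℕ) (X Y Z : Finset (Equiv.Perm (Fin n))),
      At ε n k X Y Z :=
  Iff.rfl


/-! ## The budget is never below 1 (the trivial partition `(n)` always pays `1^{2+ε}`) -/

/-- The trivial partition `(n)` always lies in the graded window `μ₁ ≥ n - k`. -/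
theorem indiscrete_sup_ge (n k : ℕ) : n - k ≤ (Nat.Partition.indiscrete n).parts.sup := by
  rcases Nat.eq_zero_or_pos n with rfl | hn
  · simp
  · rw [Nat.Partition.indiscrete_parts hn.ne', Multiset.sup_singleton]
    exact Nat.sub_le n k

/-- The graded budget is at least `1` (the term of the partition `(n)`, and `f^μ ≥ 1`). -/
theorem one_le_budget (n k : ℕ) {ε : ℝ} (hε : 0 ≤ 2 + ε) : 1 ≤ budget n k ε := by
  unfold budget
  have hterm : (1 : ℝ) ≤ (if n - k ≤ (Nat.Partition.indiscrete n).parts.sup then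
      (numStandardTableaux (Nat.Partition.indiscrete n) : ℝ) ^ (2 + ε) else 0) := by
    rw [if_pos (indiscrete_sup_ge n k)]
    have h1 : (1 : ℝ) ≤ (numStandardTableaux (Nat.Partition.indiscrete n) : ℝ) := by
      exact_mod_cast numStandardTableaux_pos_holds (Nat.Partition.indiscrete n)
    exact Real.one_le_rpow h1 hε
  refine hterm.trans ?_
  refine Finset.single_le_sum (f := fun μ : Nat.Partition n =>
      if n - k ≤ μ.parts.sup then (numStandardTableaux μ : ℝ) ^ (2 + ε) else 0) ?_
    (Finset.mem_univ _)
  intro μ _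
  split_ifs
  · positivity
  · exact le_rfl

/-! ## Small volume kills every instance -/

/-- A triple of volume `≤ 1` never satisfies the crux inequality (`budget ≥ 1 ≥ volume^{…}`). -/
theorem not_at_of_card_le_one {ε : ℝ} (hε : 0 < ε) {n k : ℕ} {X Y Z : Finset (Equiv.Perm (Fin n))}
    (hV : X.card * Y.card * Z.card ≤ 1) : ¬ At ε n k X Y Z := by
  rintro ⟨-, hlt⟩
  have h1 : volPow ε X Y Z ≤ 1 := by
    unfold volPow
    apply Real.rpow_le_one (by positivity) (by exact_mod_cast hV) (by positivity)
  have h2 := one_le_budget n k (by positivity : (0 : ℝ) ≤ 2 + ε)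
  linarith

/-! ## Level `k = 0` is dead for every `ε` (constants separate only singletons) -/

/-- `0`-token (i.e. constant) separation forces `|X|, |Y|, |Z| ≤ 1`. -/
theorem card_mul_le_one_of_sep_zero {n : ℕ} {X Y Z : Finset (Equiv.Perm (Fin n))}
    (h : Sep n 0 X Y Z) : X.card * Y.card * Z.card ≤ 1 := by
  classical
  by_cases hX : X = ∅
  · simp [hX]
  by_cases hY : Y = ∅
  · simp [hY]
  by_cases hZ : Z = ∅
  · simp [hZ]
  obtain ⟨x₀, hx₀⟩ := Finset.nonempty_iff_ne_empty.mpr hX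
  obtain ⟨y₀, hy₀⟩ := Finset.nonempty_iff_ne_empty.mpr hY
  obtain ⟨z₀, hz₀⟩ := Finset.nonempty_iff_ne_empty.mpr hZ
  obtain ⟨c, hc⟩ := h x₀ hx₀ z₀ hz₀
  -- the test functional is the constant `K`
  have hconst : ∀ g : Equiv.Perm (Fin n),
      (∑ p : Fin 0 → Fin n, c p (⇑g ∘ p)) = c default default := by
    intro g
    rw [Fintype.sum_unique]
    congr 1
    exact Subsingleton.elim _ _
  have h1 : c default default = 1 := by
    have := hc x₀ hx₀ y₀ hy₀ y₀ hy₀ z₀ hz₀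
    rw [hconst, if_pos ⟨rfl, rfl, rfl⟩] at this
    exact this
  have hXs : X ⊆ {x₀} := by
    intro x hx
    rw [Finset.mem_singleton]
    by_contra hne
    have := hc x hx y₀ hy₀ y₀ hy₀ z₀ hz₀
    rw [hconst, if_neg (fun h => hne h.1), h1] at this
    exact one_ne_zero this
  have hYs : Y ⊆ {y₀} := by
    intro y hy
    rw [Finset.mem_singleton]
    by_contra hne
    have := hc x₀ hx₀ y hy y₀ hy₀ z₀ hz₀
    rw [hconst, if_neg (fun h => hne h.2.1), h1] at this
    exact one_ne_zero this
  have hZs : Z ⊆ {z₀} := by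
    intro z hz
    rw [Finset.mem_singleton]
    by_contra hne
    have := hc x₀ hx₀ y₀ hy₀ y₀ hy₀ z hz
    rw [hconst, if_neg (fun h => hne h.2.2), h1] at this
    exact one_ne_zero this
  have := Finset.card_le_card hXs
  have := Finset.card_le_card hYs
  have := Finset.card_le_card hZs
  simp only [Finset.card_singleton] at *
  calc X.card * Y.card * Z.card ≤ 1 * 1 * 1 := by gcongr
    _ = 1 := by norm_num

/-- **Level 0 is dead for every `ε > 0`**: any proof of the crux must use `k ≥ 1`
(indeed `k ≥ 2`, see `not_at_level_one`). -/
theorem not_at_level_zero {ε : ℝ} (hε : 0 < ε) (n : ℕ) (X Y Z : Finset (Equiv.Perm (Fin n))) :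
    ¬ At ε n 0 X Y Z := fun h =>
  not_at_of_card_le_one hε (card_mul_le_one_of_sep_zero h.1) h

/-- **`n ≤ 1` is dead** (the group is trivial, the volume is at most 1, the budget at least 1). -/
theorem not_at_of_le_one {ε : ℝ} (hε : 0 < ε) {n : ℕ} (hn : n ≤ 1) (k : ℕ)
    (X Y Z : Finset (Equiv.Perm (Fin n))) : ¬ At ε n k X Y Z := by
  have hsub : Subsingleton (Equiv.Perm (Fin n)) := by
    have : Subsingleton (Fin n) := by
      rcases Nat.le_one_iff_eq_zero_or_eq_one.mp hn with rfl | rfl <;> infer_instance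
    infer_instance
  have hc : ∀ W : Finset (Equiv.Perm (Fin n)), W.card ≤ 1 := fun W =>
    Finset.card_le_one.mpr fun a _ b _ => Subsingleton.elim a b
  refine not_at_of_card_le_one hε ?_
  calc X.card * Y.card * Z.card ≤ 1 * 1 * 1 := by gcongr <;> exact hc _
    _ = 1 := by norm_num



/-! ## `f^{(n)} = 1`, the level-0 budget, and two load-bearing clauses of the rendering

* `budget_zero : budget n 0 ε = 1` — at level 0 only the trivial partition pays.
* `exists_budget_lt_volPow` — WITHOUT the separation clause the inequality is trivially
  satisfiable (`n = 2, k = 0, X = 𝔖₂, Y = Z = {1}`): separation is load-bearing.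
* `at_le_version_trivial` — with `≤` in place of `<` the crux is trivially TRUE (singletons at
  level 0: budget `1 ≤ 1` = volume): the strict inequality is load-bearing against this junk. -/

/-- A partition other than `(n)` has all parts `< n`. -/
theorem sup_lt_of_ne_indiscrete {n : ℕ} {μ : Nat.Partition n} (hμ : μ ≠ Nat.Partition.indiscrete n) :
    μ.parts.sup < n := by
  rcases Nat.eq_zero_or_pos n with rfl | hn
  · exact absurd (Subsingleton.elim μ _) hμ
  suffices hall : ∀ a ∈ μ.parts, a ≤ n - 1 by
    have := Multiset.sup_le.mpr hall
    omega
  intro a ha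
  by_contra hle
  push Not at hle
  apply hμ
  obtain ⟨rest, hrest⟩ := Multiset.exists_cons_of_mem ha
  have hsum := μ.parts_sum
  rw [hrest, Multiset.sum_cons] at hsum
  have ha_eq : a = n := by
    have : a ≤ a + rest.sum := Nat.le_add_right _ _
    omega
  have hrest0 : rest = 0 := by
    rw [Multiset.eq_zero_iff_forall_notMem]
    intro b hb
    have hbpos : 0 < b := μ.parts_pos (by rw [hrest]; exact Multiset.mem_cons_of_mem hb)
    have : b ≤ rest.sum := Multiset.le_sum_of_mem hb
    omega
  ext1
  rw [hrest, hrest0, ha_eq, Nat.Partition.indiscrete_parts hn.ne']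
  rfl

/-- `f^{(n)} = 1`: the one-row shape has exactly one standard Young tableau (Frobenius–Young
degree formula of the tree with `N = 1` row). -/
theorem numStandardTableaux_indiscrete (n : ℕ) :
    numStandardTableaux (Nat.Partition.indiscrete n) = 1 := by
  classical
  set μ := Nat.Partition.indiscrete n with hμ
  rw [Literature.NumberTheory.DiophantineGeometry.numStandardTableaux_eq_card_stdFilling]
  -- sorted parts and the diagram: one row of length n
  have hsp : μ.sortedParts = if n = 0 then [] else [n] := by
    rcases Nat.eq_zero_or_pos n with rfl | hn
    · simp [Nat.Partition.sortedParts]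
    · rw [if_neg hn.ne', Nat.Partition.sortedParts, Nat.Partition.indiscrete_parts hn.ne']
      simp
  have hmem : ∀ c : ℕ × ℕ, c ∈ μ.youngDiagram ↔ c.1 < 1 ∧ c.2 < n := by
    intro c
    rw [Nat.Partition.mem_youngDiagram_iff, hsp]
    rcases Nat.eq_zero_or_pos n with rfl | hn
    · simp
    · simp only [if_neg hn.ne', List.length_singleton]
      constructor
      · rintro ⟨h1, h2⟩
        have : c.1 = 0 := by omega
        simp only [this, List.getElem_cons_zero] at h2
        exact ⟨h1, h2⟩
      · rintro ⟨h1, h2⟩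
        refine ⟨h1, ?_⟩
        have : c.1 = 0 := by omega
        simp only [this, List.getElem_cons_zero]
        exact h2
  have hN : ∀ c ∈ μ.youngDiagram.cells, c.1 < 1 := fun c hc =>
    ((hmem c).1 ((YoungDiagram.mem_cells _).1 hc)).1
  have hrow : μ.youngDiagram.rowLen 0 = n :=
    YoungDiagram.rowLen_eq_of_forall_mem_iff (fun j => by rw [hmem]; simp)
  have key := Literature.NumberTheory.DiophantineGeometry.card_stdFilling_mul_prod_factorial
    1 n μ.youngDiagram μ.card_cells_youngDiagram hN
  simp only [Finset.range_one, Finset.prod_singleton, hrow, Nat.sub_self, add_zero] at key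
  have hIoo : Finset.Ioo 0 1 = ∅ := by decide
  rw [hIoo, Finset.prod_empty, mul_one] at key
  have hfac : (n.factorial : ℚ) ≠ 0 := by exact_mod_cast n.factorial_ne_zero
  have : (Nat.card (Literature.NumberTheory.DiophantineGeometry.StdFilling n μ.youngDiagram) : ℚ) = 1 := by
    field_simp at key
    linarith [key]
  exact_mod_cast this

/-- At level `0` only the trivial partition pays: `budget n 0 ε = 1`. -/
theorem budget_zero (n : ℕ) (ε : ℝ) : budget n 0 ε = 1 := by
  classical
  unfold budget
  rw [Finset.sum_eq_single (Nat.Partition.indiscrete n)]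
  · rw [if_pos (indiscrete_sup_ge n 0), numStandardTableaux_indiscrete]
    simp
  · intro μ _ hμ
    rw [if_neg]
    have := sup_lt_of_ne_indiscrete hμ
    omega
  · intro h; exact absurd (Finset.mem_univ _) h

/-- LOAD-BEARING (separation): with the separation clause dropped, the inequality
`budget < volume^{(2+ε)/3}` is trivially satisfiable for every `ε > 0`. -/
theorem exists_budget_lt_volPow {ε : ℝ} (hε : 0 < ε) :
    ∃ (n k : ℕ) (X Y Z : Finset (Equiv.Perm (Fin n))), budget n k ε < volPow ε X Y Z := by
  classical
  refine ⟨2, 0, Finset.univ, {1}, {1}, ?_⟩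
  rw [budget_zero]
  unfold volPow
  rw [Finset.card_univ, Fintype.card_perm, Fintype.card_fin, Finset.card_singleton]
  norm_num
  exact Real.one_lt_rpow (by norm_num) (by positivity)

/-- Singletons are `0`-token separated (the constant test functional `1`). -/
theorem sep_zero_singleton {n : ℕ} (x y z : Equiv.Perm (Fin n)) : Sep n 0 {x} {y} {z} := by
  intro x₀ hx₀ z₀ hz₀
  refine ⟨fun _ _ => 1, ?_⟩
  intro x' hx' y' hy' y'' hy'' z' hz'
  simp only [Finset.mem_singleton] at hx₀ hz₀ hx' hy' hy'' hz'
  subst hx₀; subst hz₀; subst hx'; subst hy'; subst hy''; subst hz'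
  simp

/-- LOAD-BEARING (strictness): the `≤`-version of the crux inequality is met with EQUALITY by
singletons at level 0 (`budget = 1 = volume`), for every `ε`; the strict `<` excludes exactly
this junk (cf. `not_at_level_zero`). -/
theorem at_le_version_trivial (ε : ℝ) (n : ℕ) :
    ∃ (k : ℕ) (X Y Z : Finset (Equiv.Perm (Fin n))),
      Sep n k X Y Z ∧ budget n k ε = volPow ε X Y Z := by
  refine ⟨0, {1}, {1}, {1}, sep_zero_singleton 1 1 1, ?_⟩
  rw [budget_zero]
  unfold volPow
  simp

end

end Summit.MatrixMultiplication.MatrixMultiplication.Theorems.SnLevelDesigns.Negative
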